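import Summits.ValiantsHypothesis.ValiantsHypothesis.Theorems.LacunarySymmetroidMatrixDescartesDoorA26WallBubblingEventualSigns

/-!
# `DoorA26` / line `wall_bubbling` — INSERTING THREE MOVING ABSCISSAE at an even-order zero (frame lemma for the order-4 opening)

HONEST FRAMING.  Object-search cell `pub-symmetroid`, crux `Theses.LacunarySymmetroid.DoorA26` (stmt-ValiantsHypothesis-19979; OPEN, typed,
never asserted).  W2 seat val-sym-door-p1 g19, file #71; def-free helper for obligation (R) of `Cruxes/DoorA26/Lines/wall_bubbling.lean`.
The order-4 opening (memo `DOOR-A26-P1G19-NO-BALANCE.md` §7g) produces four simple zeros `t⋆ ± η^{1/2}ρ₁, t⋆ ± η^{1/2}ρ₂` out of a quadruple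
zero; the sign frame then consists of 18 OUTER abscissae (fixed; `t⋆` in the gap after position `j⋆`) and three INNER ones `t⋆ − ε(η), t⋆, t⋆ + ε(η)`
with `ε(η) → 0⁺`.  This file does the index bookkeeping once: from eventual signs at the 18 + 3 abscissae (outer signs `κ` alternating except
across the gap `j⋆`, where they agree; inner signs `−κ_{j⋆}, κ_{j⋆}, −κ_{j⋆}`) to `δ ∈ TwentyLocus` via #69 `mem_twentyLocus_of_eventually_alternating`.
Imports #69 `…EventualSigns`.

WHAT IS HERE.  ★ `mem_twentyLocus_of_insert_three`.  Nothing here bears on `DoorA26`, `DoorA34`, (W)/(M)/(R), `MatrixDescartes` (18050) or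
`VP ≠ VNP`; registers unchanged.

[folklore] bookkeeping.  [this work] the packaging.
-/

set_option linter.dupNamespace false

namespace Summit.ValiantsHypothesis.ValiantsHypothesis.Theorems.LacunarySymmetroidMatrixDescartes.WallBubbling

open Finset Filter Topology
open Bubbling (TwentyLocus)

/-- ★ **Three inner abscissae.**  Letters `Sη η` (symmetric), 18 outer abscissae `τ` (strictly increasing) with `τ_{j⋆} < t⋆ < τ_{j⋆+1}`, a width
`ε(η) → 0` positive for small `η`; outer target signs `κ` alternating except across `j⋆` (where `κ_{j⋆} κ_{j⋆+1} > 0`); eventual signs: `κ_j` at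
`τ_j`, and `−κ_{j⋆}, κ_{j⋆}, −κ_{j⋆}` at `t⋆ − ε(η), t⋆, t⋆ + ε(η)`.  Then `δ ∈ TwentyLocus`. [this work] -/
theorem mem_twentyLocus_of_insert_three (δ : Fin 6 → ℝ) (Sη : ℝ → Fin 6 → Matrix (Fin 2) (Fin 2) ℝ)
    (hS : ∀ η l, (Sη η l).IsSymm) (τ : Fin 18 → ℝ) (hτ : StrictMono τ) (jstar : Fin 17) (tstar : ℝ)
    (ht1 : τ jstar.castSucc < tstar) (ht2 : tstar < τ jstar.succ)
    (ε : ℝ → ℝ) (hε : Tendsto ε (𝓝[>] 0) (𝓝 0)) (hεpos : ∀ᶠ η in 𝓝[>] (0 : ℝ), 0 < ε η)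
    (κ : Fin 18 → ℝ) (halt : ∀ j : Fin 17, j ≠ jstar → κ j.castSucc * κ j.succ < 0)
    (hsame : 0 < κ jstar.castSucc * κ jstar.succ)
    (houter : ∀ j, ∀ᶠ η in 𝓝[>] (0 : ℝ), 0 < κ j * (∑ l, Real.exp (δ l * τ j) • Sη η l).det)
    (hinL : ∀ᶠ η in 𝓝[>] (0 : ℝ), 0 < -κ jstar.castSucc * (∑ l, Real.exp (δ l * (tstar - ε η)) • Sη η l).det)
    (hin0 : ∀ᶠ η in 𝓝[>] (0 : ℝ), 0 < κ jstar.castSucc * (∑ l, Real.exp (δ l * tstar) • Sη η l).det)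
    (hinR : ∀ᶠ η in 𝓝[>] (0 : ℝ), 0 < -κ jstar.castSucc * (∑ l, Real.exp (δ l * (tstar + ε η)) • Sη η l).det) :
    δ ∈ TwentyLocus := by
  classical
  -- extend `τ`, `κ` to `ℕ`
  let τN : ℕ → ℝ := fun n => if h : n < 18 then τ ⟨n, h⟩ else 0
  let κN : ℕ → ℝ := fun n => if h : n < 18 then κ ⟨n, h⟩ else 0
  have hτN : ∀ n (h : n < 18), τN n = τ ⟨n, h⟩ := fun n h => by simp [τN, h]
  have hκN : ∀ n (h : n < 18), κN n = κ ⟨n, h⟩ := fun n h => by simp [κN, h]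
  set J : ℕ := (jstar : ℕ) with hJ
  have hJ17 : J < 17 := jstar.2
  -- the 21 abscissae and signs
  let τ' : ℝ → Fin 21 → ℝ := fun η i =>
    if (i : ℕ) ≤ J then τN i else if (i : ℕ) = J + 1 then tstar - ε η else if (i : ℕ) = J + 2 then tstar
    else if (i : ℕ) = J + 3 then tstar + ε η else τN (i - 3)
  let κ' : Fin 21 → ℝ := fun i =>
    if (i : ℕ) ≤ J then κN i else if (i : ℕ) = J + 1 then -κN J else if (i : ℕ) = J + 2 then κN J
    else if (i : ℕ) = J + 3 then -κN J else κN (i - 3)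
  -- evaluation lemmas
  have τA : ∀ η (i : Fin 21), (i : ℕ) ≤ J → τ' η i = τN i := fun η i hi => by simp [τ', hi]
  have τB1 : ∀ η (i : Fin 21), (i : ℕ) = J + 1 → τ' η i = tstar - ε η := fun η i hi => by
    simp [τ', hi]
  have τB2 : ∀ η (i : Fin 21), (i : ℕ) = J + 2 → τ' η i = tstar := fun η i hi => by
    simp [τ', hi]
  have τB3 : ∀ η (i : Fin 21), (i : ℕ) = J + 3 → τ' η i = tstar + ε η := fun η i hi => by
    simp [τ', hi]
  have τC : ∀ η (i : Fin 21), J + 4 ≤ (i : ℕ) → τ' η i = τN (i - 3) := fun η i hi => by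
    have h1 : ¬ (i : ℕ) ≤ J := by omega
    have h2 : (i : ℕ) ≠ J + 1 := by omega
    have h3 : (i : ℕ) ≠ J + 2 := by omega
    have h4 : (i : ℕ) ≠ J + 3 := by omega
    simp [τ', h1, h2, h3, h4]
  have κA : ∀ (i : Fin 21), (i : ℕ) ≤ J → κ' i = κN i := fun i hi => by simp [κ', hi]
  have κB1 : ∀ (i : Fin 21), (i : ℕ) = J + 1 → κ' i = -κN J := fun i hi => by simp [κ', hi]
  have κB2 : ∀ (i : Fin 21), (i : ℕ) = J + 2 → κ' i = κN J := fun i hi => by simp [κ', hi]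
  have κB3 : ∀ (i : Fin 21), (i : ℕ) = J + 3 → κ' i = -κN J := fun i hi => by simp [κ', hi]
  have κC : ∀ (i : Fin 21), J + 4 ≤ (i : ℕ) → κ' i = κN (i - 3) := fun i hi => by
    have h1 : ¬ (i : ℕ) ≤ J := by omega
    have h2 : (i : ℕ) ≠ J + 1 := by omega
    have h3 : (i : ℕ) ≠ J + 2 := by omega
    have h4 : (i : ℕ) ≠ J + 3 := by omega
    simp [κ', h1, h2, h3, h4]
  -- facts about `τN`, `κN`
  have τN_lt : ∀ n, n + 1 < 18 → τN n < τN (n + 1) := fun n hn => by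
    rw [hτN n (by omega), hτN (n + 1) hn]
    exact hτ (Fin.mk_lt_mk.2 (Nat.lt_succ_self n))
  have κN_alt : ∀ n, n + 1 < 18 → n ≠ J → κN n * κN (n + 1) < 0 := fun n hn hnJ => by
    rw [hκN n (by omega), hκN (n + 1) hn]
    have := halt ⟨n, by omega⟩ (fun h => hnJ (by rw [hJ, ← h]))
    simpa [Fin.castSucc_mk, Fin.succ_mk] using this
  have κN_J : κN J = κ jstar.castSucc := by rw [hκN J (by omega)]; rfl
  have κN_J1 : κN (J + 1) = κ jstar.succ := by rw [hκN (J + 1) (by omega)]; rfl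
  have τN_J : τN J = τ jstar.castSucc := by rw [hτN J (by omega)]; rfl
  have τN_J1 : τN (J + 1) = τ jstar.succ := by rw [hτN (J + 1) (by omega)]; rfl
  have hκJ0 : κN J ≠ 0 := by
    intro h; rw [κN_J] at h; rw [h, zero_mul] at hsame; exact lt_irrefl _ hsame
  -- eventual strict monotonicity
  have hgap : ∀ᶠ η in 𝓝[>] (0 : ℝ), ε η < min (tstar - τ jstar.castSucc) (τ jstar.succ - tstar) :=
    hε.eventually (eventually_lt_nhds (lt_min (by linarith) (by linarith)))
  have hmono : ∀ᶠ η in 𝓝[>] (0 : ℝ), StrictMono (τ' η) := by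
    filter_upwards [hgap, hεpos] with η hg hp
    have hgL : ε η < tstar - τ jstar.castSucc := lt_of_lt_of_le hg (min_le_left _ _)
    have hgR : ε η < τ jstar.succ - tstar := lt_of_lt_of_le hg (min_le_right _ _)
    refine Fin.strictMono_iff_lt_succ.2 fun i => ?_
    have hi := i.2
    have hcs : ((i.castSucc : Fin 21) : ℕ) = (i : ℕ) := rfl
    have hsc : ((i.succ : Fin 21) : ℕ) = (i : ℕ) + 1 := by simp
    rcases Nat.lt_or_ge ((i : ℕ) + 1) (J + 1) with h | h
    · -- both outer, left block
      rw [τA η _ (by rw [hcs]; omega), τA η _ (by rw [hsc]; omega), hcs, hsc]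
      exact τN_lt _ (by omega)
    · rcases Nat.lt_or_ge (i : ℕ) (J + 4) with h' | h'
      · -- the five positions around the inner block
        have hcases : (i : ℕ) = J ∨ (i : ℕ) = J + 1 ∨ (i : ℕ) = J + 2 ∨ (i : ℕ) = J + 3 := by omega
        rcases hcases with e | e | e | e
        · rw [τA η _ (by rw [hcs]; omega), τB1 η _ (by rw [hsc]; omega), hcs, e, τN_J]; linarith
        · rw [τB1 η _ (by rw [hcs]; omega), τB2 η _ (by rw [hsc]; omega)]; linarith
        · rw [τB2 η _ (by rw [hcs]; omega), τB3 η _ (by rw [hsc]; omega)]; linarith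
        · rw [τB3 η _ (by rw [hcs]; omega), τC η _ (by rw [hsc]; omega), hsc, e]
          rw [show J + 3 + 1 - 3 = J + 1 by omega, τN_J1]; linarith
      · rw [τC η _ (by rw [hcs]; omega), τC η _ (by rw [hsc]; omega), hcs, hsc]
        rw [show (i : ℕ) + 1 - 3 = ((i : ℕ) - 3) + 1 by omega]
        exact τN_lt _ (by omega)
  -- alternation of `κ'`
  have halt' : ∀ i : Fin 20, κ' i.castSucc * κ' i.succ < 0 := by
    intro i
    have hi := i.2
    have hcs : ((i.castSucc : Fin 21) : ℕ) = (i : ℕ) := rfl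
    have hsc : ((i.succ : Fin 21) : ℕ) = (i : ℕ) + 1 := by simp
    have hsq : 0 < κN J * κN J := mul_self_pos.2 hκJ0
    rcases Nat.lt_or_ge ((i : ℕ) + 1) (J + 1) with h | h
    · rw [κA _ (by rw [hcs]; omega), κA _ (by rw [hsc]; omega), hcs, hsc]
      exact κN_alt _ (by omega) (by omega)
    · rcases Nat.lt_or_ge (i : ℕ) (J + 4) with h' | h'
      · have hcases : (i : ℕ) = J ∨ (i : ℕ) = J + 1 ∨ (i : ℕ) = J + 2 ∨ (i : ℕ) = J + 3 := by omega
        rcases hcases with e | e | e | e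
        · rw [κA _ (by rw [hcs]; omega), κB1 _ (by rw [hsc]; omega), hcs, e]; linarith
        · rw [κB1 _ (by rw [hcs]; omega), κB2 _ (by rw [hsc]; omega)]; linarith
        · rw [κB2 _ (by rw [hcs]; omega), κB3 _ (by rw [hsc]; omega)]; linarith
        · rw [κB3 _ (by rw [hcs]; omega), κC _ (by rw [hsc]; omega), hsc, e]
          rw [show J + 3 + 1 - 3 = J + 1 by omega, κN_J, κN_J1]; linarith
      · rw [κC _ (by rw [hcs]; omega), κC _ (by rw [hsc]; omega), hcs, hsc]
        rw [show (i : ℕ) + 1 - 3 = ((i : ℕ) - 3) + 1 by omega]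
        exact κN_alt _ (by omega) (by omega)
  -- eventual signs at the 21 abscissae
  have hsign' : ∀ i : Fin 21, ∀ᶠ η in 𝓝[>] (0 : ℝ), 0 < κ' i * (∑ l, Real.exp (δ l * τ' η i) • Sη η l).det := by
    intro i
    rcases Nat.lt_or_ge (i : ℕ) (J + 1) with h | h
    · have hi18 : (i : ℕ) < 18 := by omega
      refine (houter ⟨i, hi18⟩).mono fun η hη => ?_
      rw [τA η i (by omega), κA i (by omega), hτN _ hi18, hκN _ hi18]; exact hη
    · rcases Nat.lt_or_ge (i : ℕ) (J + 4) with h' | h'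
      · have hcases : (i : ℕ) = J + 1 ∨ (i : ℕ) = J + 2 ∨ (i : ℕ) = J + 3 := by omega
        rcases hcases with e | e | e
        · refine hinL.mono fun η hη => ?_
          rw [τB1 η i e, κB1 i e, κN_J]; exact hη
        · refine hin0.mono fun η hη => ?_
          rw [τB2 η i e, κB2 i e, κN_J]; exact hη
        · refine hinR.mono fun η hη => ?_
          rw [τB3 η i e, κB3 i e, κN_J]; exact hη
      · have hi18 : (i : ℕ) - 3 < 18 := by omega
        refine (houter ⟨(i : ℕ) - 3, hi18⟩).mono fun η hη => ?_
        rw [τC η i h', κC i h', hτN _ hi18, hκN _ hi18]; exact hη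
  exact mem_twentyLocus_of_eventually_alternating δ Sη hS τ' hmono κ' halt' hsign'

end Summit.ValiantsHypothesis.ValiantsHypothesis.Theorems.LacunarySymmetroidMatrixDescartes.WallBubbling
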